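import Mathlib
import Summits.Ventures.PercRepro2.TwoMarkHubModel
import Summits.Ventures.PercRepro2.TypedFactor
import Summits.Ventures.PercRepro2.OStarGlueStar

/-!
# A two-mark hub and its glued state (blind cell PercRepro2, mine-2 g40, 2026-08-28;
`proofs/MINE2-HUBK5.md` §2, row M2-85 — part I of the hub gluing lemma)

A HUB (`Hub`): seven optional slot edges, the `i`-th with the ends of the `i`-th slot edge of
`K₅` under the marks (`mark`), every edge at a confined mark one of them, the five marks
distinct.  With the hub closed (`closeHub`) the confined marks are isolated
(`conn_closeHub_confined`); the rest's pattern `pat x` reads the three boundary connections, the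
neighbour set `nbr slot x` the seven slot values.  **`Hub.conn_iff_model`** — THE GLUING LEMMA
FOR CONNECTIONS: two marks are joined in the configuration iff they are joined in the `K₅`
configuration `cfg h (pat x) (nbr slot x)` of `TwoMarkHubModel.lean` (a closure argument in each
direction, `mem_of_conn_of_closed`); hence **`Hub.st_eq_S`**: the state of a copy is the glued
state `S h (pat x) (nbr slot x)`.  The two sides of a typed set (`sideA`: the typed hub edges,
`sideB`: the rest), the neighbour set only seeing `sideA` and the pattern only `sideB`.  Own
code; standard axioms.
-/

namespace Summit.Ventures.PercRepro2

open UnionCluster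

namespace CovForm

namespace THub

open OneTyped Untouched OStar K5 TypedFactor

/-! ## The hub -/

section Structure

variable {V : Type*} {E : Type*}

/-- The five marks indexed as in `K₅`: `o = 0, a₁ = 1, a₂ = 2, a₃ = 3, b = 4`. -/
def mark (o a₁ a₂ a₃ b : V) : Fin 5 → V := ![o, a₁, a₂, a₃, b]

/-- **A two-mark hub**: seven optional slot edges, the `i`-th with the ends of the `i`-th slot
edge of `K₅` under the marks; every edge at a confined mark is a slot; the marks distinct. -/
structure IsHub (ends : E → Sym2 V) (o a₁ a₂ a₃ b : V) (h : HubType) (slot : Fin 7 → Option E) :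
    Prop where
  hslot : ∀ i e, slot i = some e → ends e = (ends5 (h.slotE i)).map (mark o a₁ a₂ a₃ b)
  all : ∀ e, mark o a₁ a₂ a₃ b h.c₁ ∈ ends e ∨ mark o a₁ a₂ a₃ b h.c₂ ∈ ends e →
    ∃ i, slot i = some e
  inj : Function.Injective (mark o a₁ a₂ a₃ b)

variable {ends : E → Sym2 V} {o a₁ a₂ a₃ b : V} {h : HubType} {slot : Fin 7 → Option E}

/-- `ends5` is injective. -/
lemma ends5_injective : Function.Injective ends5 := by
  intro e e' hee'
  fin_cases e <;> fin_cases e' <;> first | rfl | exact absurd hee' (by decide)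

/-- A slot edge is a hub edge. -/
lemma IsHub.mem_of_slot (hH : IsHub ends o a₁ a₂ a₃ b h slot) {i : Fin 7} {e : E}
    (hi : slot i = some e) :
    mark o a₁ a₂ a₃ b h.c₁ ∈ ends e ∨ mark o a₁ a₂ a₃ b h.c₂ ∈ ends e := by
  rw [hH.hslot i e hi]
  rcases h.confined_mem_slot i with hc | hc
  · exact Or.inl (Sym2.mem_map.2 ⟨h.c₁, hc, rfl⟩)
  · exact Or.inr (Sym2.mem_map.2 ⟨h.c₂, hc, rfl⟩)

/-- Distinct slots are distinct edges. -/
lemma IsHub.ne_of_slots (hH : IsHub ends o a₁ a₂ a₃ b h slot) {i j : Fin 7} (hij : i ≠ j) {e e' : E}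
    (hi : slot i = some e) (hj : slot j = some e') : e ≠ e' := by
  rintro rfl
  have := (hH.hslot i e hi).symm.trans (hH.hslot j e hj)
  exact hij (h.slotE_injective (ends5_injective (Sym2.map.injective hH.inj this)))

/-- The ends of a slot edge are the marks of its `K₅` edge. -/
lemma IsHub.ends_slot_eq (hH : IsHub ends o a₁ a₂ a₃ b h slot) {i : Fin 7} {e : E}
    (hi : slot i = some e) {q₁ q₂ : Fin 5} (hq : ends5 (h.slotE i) = s(q₁, q₂)) :
    ends e = s(mark o a₁ a₂ a₃ b q₁, mark o a₁ a₂ a₃ b q₂) := by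
  rw [hH.hslot i e hi, hq, Sym2.map_mk]

/-- A slot edge with marked ends `(q₁, q₂)` is the `K₅` edge `s(q₁, q₂)`. -/
lemma IsHub.ends5_slot_eq (hH : IsHub ends o a₁ a₂ a₃ b h slot) {i : Fin 7} {e : E}
    (hi : slot i = some e) {q₁ q₂ : Fin 5}
    (hq : ends e = s(mark o a₁ a₂ a₃ b q₁, mark o a₁ a₂ a₃ b q₂)) :
    ends5 (h.slotE i) = s(q₁, q₂) := by
  apply Sym2.map.injective hH.inj
  rw [← hH.hslot i e hi, hq, Sym2.map_mk]

end Structure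

/-! ## Closing the hub -/

section Close

variable {V : Type*} {E : Type*} [DecidableEq V]

/-- The configuration with every edge at the two confined marks closed. -/
def closeHub (ends : E → Sym2 V) (c c' : V) (ω : Config E) : Config E :=
  fun e => if c ∈ ends e ∨ c' ∈ ends e then false else ω e

variable {ends : E → Sym2 V} {c c' : V}

/-- An edge at a confined mark is closed. -/
lemma closeHub_apply_of_mem {ω : Config E} {e : E} (he : c ∈ ends e ∨ c' ∈ ends e) :
    closeHub ends c c' ω e = false := by
  simp only [closeHub, if_pos he]

/-- An edge at no confined mark keeps its value. -/
lemma closeHub_apply_of_not_mem {ω : Config E} {e : E} (he : ¬ (c ∈ ends e ∨ c' ∈ ends e)) :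
    closeHub ends c c' ω e = ω e := by
  simp only [closeHub, if_neg he]

/-- Closing the hub lowers the configuration. -/
lemma closeHub_le (ω : Config E) : closeHub ends c c' ω ≤ ω := by
  intro e
  by_cases he : c ∈ ends e ∨ c' ∈ ends e
  · rw [closeHub_apply_of_mem he]; exact Bool.false_le _
  · rw [closeHub_apply_of_not_mem he]

/-- With the hub closed a confined mark is isolated. -/
lemma conn_closeHub_confined {ω : Config E} {d v : V} (hd : d = c ∨ d = c')
    (hconn : Conn ends (closeHub ends c c' ω) d v) : v = d := by
  have key := mem_of_conn_of_closed (ends := ends) (ω := closeHub ends c c' ω) (S := {w | w = d})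
    (fun w hw u hwu => ?_) rfl hconn
  · exact key
  · obtain ⟨_, e', he', hends'⟩ := openGraph_adj.1 hwu
    exfalso
    have hmem : c ∈ ends e' ∨ c' ∈ ends e' := by
      rw [hends', hw]
      rcases hd with rfl | rfl
      · exact Or.inl (Sym2.mem_mk_left _ _)
      · exact Or.inr (Sym2.mem_mk_left _ _)
    rw [closeHub_apply_of_mem hmem] at he'
    exact Bool.false_ne_true he'

end Close

/-! ## The neighbour set, the pattern and the glued state -/

section Glue

variable {V : Type*} {E : Type*} [DecidableEq V]
variable (ends : E → Sym2 V) (o a₁ a₂ a₃ b : V) (h : HubType) (slot : Fin 7 → Option E)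

/-- The open slots of a configuration. -/
def nbr (x : Config E) : Nb7 :=
  (val (slot 0) x, val (slot 1) x, val (slot 2) x, val (slot 3) x, val (slot 4) x, val (slot 5) x,
    val (slot 6) x)

/-- The bit of the neighbour set is the slot's value. -/
lemma nbr_get (x : Config E) (i : Fin 7) : (nbr slot x).get i = val (slot i) x := by
  fin_cases i <;> rfl

open Classical in
/-- The rest's pattern on the boundary marks: the bits `(a₁x, a₂x, a₁a₂)` with the hub closed. -/
noncomputable def pat (x : Config E) : Pat3 :=
  (decide (Conn ends (closeHub ends (mark o a₁ a₂ a₃ b h.c₁) (mark o a₁ a₂ a₃ b h.c₂) x) (mark o a₁ a₂ a₃ b 1) (mark o a₁ a₂ a₃ b h.x)),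
    decide (Conn ends (closeHub ends (mark o a₁ a₂ a₃ b h.c₁) (mark o a₁ a₂ a₃ b h.c₂) x) (mark o a₁ a₂ a₃ b 2) (mark o a₁ a₂ a₃ b h.x)),
    decide (Conn ends (closeHub ends (mark o a₁ a₂ a₃ b h.c₁) (mark o a₁ a₂ a₃ b h.c₂) x) (mark o a₁ a₂ a₃ b 1) (mark o a₁ a₂ a₃ b 2)))

variable {ends o a₁ a₂ a₃ b h slot}

/-- The bit of the pattern is the rest's connection of the boundary pair. -/
lemma pat_get (x : Config E) (m : Fin 3) :
    (pat ends o a₁ a₂ a₃ b h x).get m = true ↔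
      Conn ends (closeHub ends (mark o a₁ a₂ a₃ b h.c₁) (mark o a₁ a₂ a₃ b h.c₂) x) (mark o a₁ a₂ a₃ b (h.bdPair m).1)
        (mark o a₁ a₂ a₃ b (h.bdPair m).2) := by
  fin_cases m <;> simp only [pat, Pat3.get, HubType.bdPair, decide_eq_true_eq] <;> rfl

/-- The pattern is transitive. -/
lemma valid_pat (x : Config E) : valid (pat ends o a₁ a₂ a₃ b h x) = true := by
  simp only [valid, pat, Bool.or_eq_true, Bool.not_eq_eq_eq_not, Bool.not_true, Bool.and_eq_false_iff,
    decide_eq_false_iff_not, decide_eq_true_eq]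
  by_cases h1 : Conn ends (closeHub ends (mark o a₁ a₂ a₃ b h.c₁) (mark o a₁ a₂ a₃ b h.c₂) x) (mark o a₁ a₂ a₃ b 1) (mark o a₁ a₂ a₃ b h.x)
  · by_cases h2 : Conn ends (closeHub ends (mark o a₁ a₂ a₃ b h.c₁) (mark o a₁ a₂ a₃ b h.c₂) x) (mark o a₁ a₂ a₃ b 2)
        (mark o a₁ a₂ a₃ b h.x)
    · exact Or.inr (conn_trans h1 (conn_symm h2))
    · exact Or.inl (Or.inr h2)
  · exact Or.inl (Or.inl h1)

/-- A rest connection between two marks is a model connection. -/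
lemma IsHub.conn_model_of_closeH (hH : IsHub ends o a₁ a₂ a₃ b h slot) (x : Config E) {j p : Fin 5}
    (hc : Conn ends (closeHub ends (mark o a₁ a₂ a₃ b h.c₁) (mark o a₁ a₂ a₃ b h.c₂) x) (mark o a₁ a₂ a₃ b j) (mark o a₁ a₂ a₃ b p)) :
    Conn ends5 (cfg h (pat ends o a₁ a₂ a₃ b h x) (nbr slot x)) j p := by
  by_cases hjp : j = p
  · subst hjp; exact conn_refl _ _ _
  have hj : j ≠ h.c₁ ∧ j ≠ h.c₂ := by
    constructor
    · rintro rfl; exact hjp (hH.inj (conn_closeHub_confined (Or.inl rfl) hc)).symm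
    · rintro rfl; exact hjp (hH.inj (conn_closeHub_confined (Or.inr rfl) hc)).symm
  have hp : p ≠ h.c₁ ∧ p ≠ h.c₂ := by
    constructor
    · rintro rfl; exact hjp (hH.inj (conn_closeHub_confined (Or.inl rfl) (conn_symm hc)))
    · rintro rfl; exact hjp (hH.inj (conn_closeHub_confined (Or.inr rfl) (conn_symm hc)))
  obtain ⟨m, hm⟩ := h.exists_bd_of_ne j p hjp hj.1 hj.2 hp.1 hp.2
  refine conn_of_openAdj ⟨h.bdE m, ?_, hm⟩
  rw [cfg_bdE, pat_get]
  have := (h.ends5_bdE m).symm.trans hm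
  rw [Sym2.eq_iff] at this
  rcases this with ⟨h1, h2⟩ | ⟨h1, h2⟩
  · rw [h1, h2]; exact hc
  · rw [h1, h2]; exact conn_symm hc

/-- An open slot is a model adjacency. -/
lemma openAdj_model_of_slot (x : Config E) {i : Fin 7}
    {e : E} (hi : slot i = some e) (he : x e = true) {q₁ q₂ : Fin 5}
    (hq : ends5 (h.slotE i) = s(q₁, q₂)) :
    OpenAdj ends5 (cfg h (pat ends o a₁ a₂ a₃ b h x) (nbr slot x)) q₁ q₂ := by
  refine ⟨h.slotE i, ?_, hq⟩
  rw [cfg_slotE, nbr_get, hi]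
  exact he

/-- **The gluing lemma for connections**: two marks are joined in the configuration iff they are
joined in the `K₅` model configuration. -/
theorem IsHub.conn_iff_model (hH : IsHub ends o a₁ a₂ a₃ b h slot) (x : Config E) (u v : Fin 5) :
    Conn ends x (mark o a₁ a₂ a₃ b u) (mark o a₁ a₂ a₃ b v) ↔
      Conn ends5 (cfg h (pat ends o a₁ a₂ a₃ b h x) (nbr slot x)) u v := by
  constructor
  · intro hc
    have key := mem_of_conn_of_closed (ends := ends) (ω := x)
      (S := {w | ∃ j : Fin 5, Conn ends5 (cfg h (pat ends o a₁ a₂ a₃ b h x) (nbr slot x)) u j ∧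
        Conn ends (closeHub ends (mark o a₁ a₂ a₃ b h.c₁) (mark o a₁ a₂ a₃ b h.c₂) x) (mark o a₁ a₂ a₃ b j) w})
      (fun w hw w' hww' => ?_) ⟨u, conn_refl _ _ _, conn_refl _ _ _⟩ hc
    · obtain ⟨j, hj, hjv⟩ := key
      exact conn_trans hj (hH.conn_model_of_closeH x hjv)
    · obtain ⟨j, hj, hjw⟩ := hw
      obtain ⟨_, e, he, hends⟩ := openGraph_adj.1 hww'
      by_cases hhub : mark o a₁ a₂ a₃ b h.c₁ ∈ ends e ∨ mark o a₁ a₂ a₃ b h.c₂ ∈ ends e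
      · obtain ⟨i, hi⟩ := hH.all e hhub
        obtain ⟨⟨q₁, q₂⟩, hq⟩ := Quot.exists_rep (ends5 (h.slotE i))
        have hq' : ends5 (h.slotE i) = s(q₁, q₂) := hq.symm
        have hends' := (hH.ends_slot_eq hi hq').symm.trans hends
        rw [Sym2.eq_iff] at hends'
        rcases hends' with ⟨h1, h2⟩ | ⟨h1, h2⟩
        · refine ⟨q₂, ?_, by rw [← h2]; exact conn_refl _ _ _⟩
          rw [← h1] at hjw
          exact conn_trans (conn_trans hj (hH.conn_model_of_closeH x hjw))
            (conn_of_openAdj (openAdj_model_of_slot x hi he hq'))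
        · refine ⟨q₁, ?_, by rw [← h1]; exact conn_refl _ _ _⟩
          rw [← h2] at hjw
          exact conn_trans (conn_trans hj (hH.conn_model_of_closeH x hjw))
            (conn_of_openAdj (openAdj_model_of_slot x hi he hq').symm)
      · refine ⟨j, hj, conn_trans hjw (conn_of_openAdj ⟨e, ?_, hends⟩)⟩
        rw [closeHub_apply_of_not_mem hhub]
        exact he
  · intro hc
    have key := mem_of_conn_of_closed (ends := ends5)
      (ω := cfg h (pat ends o a₁ a₂ a₃ b h x) (nbr slot x))
      (S := {j : Fin 5 | Conn ends x (mark o a₁ a₂ a₃ b u) (mark o a₁ a₂ a₃ b j)})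
      (fun j hj k hjk => ?_) (conn_refl _ _ _) hc
    · exact key
    · obtain ⟨_, e5, he5, hends5⟩ := openGraph_adj.1 hjk
      refine conn_trans hj ?_
      rcases h.slot_or_bd e5 with ⟨i, rfl⟩ | ⟨m, rfl⟩
      · rw [cfg_slotE, nbr_get] at he5
        cases hi : slot i with
        | none => rw [hi] at he5; exact absurd he5 Bool.false_ne_true
        | some e =>
          rw [hi] at he5
          exact conn_of_openAdj ⟨e, he5, hH.ends_slot_eq hi hends5⟩
      · rw [cfg_bdE, pat_get] at he5
        have := (h.ends5_bdE m).symm.trans hends5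
        rw [Sym2.eq_iff] at this
        rcases this with ⟨h1, h2⟩ | ⟨h1, h2⟩
        · rw [h1, h2] at he5
          exact conn_mono (closeHub_le x) he5
        · rw [h1, h2] at he5
          exact conn_mono (closeHub_le x) (conn_symm he5)

/-- The decided connection between two marks is the model's bitmask connectivity. -/
lemma IsHub.decide_conn_eq (hH : IsHub ends o a₁ a₂ a₃ b h slot) (x : Config E) (u v : Fin 5)
    {d : Decidable (Conn ends x (mark o a₁ a₂ a₃ b u) (mark o a₁ a₂ a₃ b v))} :
    @decide (Conn ends x (mark o a₁ a₂ a₃ b u) (mark o a₁ a₂ a₃ b v)) d =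
      conn (cfg h (pat ends o a₁ a₂ a₃ b h x) (nbr slot x)) u v := by
  rw [Bool.eq_iff_iff, decide_eq_true_eq, hH.conn_iff_model x u v]
  exact (conn_iff _ _ _).symm

/-- **The gluing lemma for states**: the state of a copy is the glued state of the rest's pattern
and the open slots. -/
theorem IsHub.st_eq_S (hH : IsHub ends o a₁ a₂ a₃ b h slot) (x : Config E) :
    st ends o a₁ a₂ a₃ b x = S h (pat ends o a₁ a₂ a₃ b h x) (nbr slot x) := by
  unfold st S
  simp only [Prod.mk.injEq]
  exact ⟨hH.decide_conn_eq x 2 1, hH.decide_conn_eq x 1 0, hH.decide_conn_eq x 2 0,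
    hH.decide_conn_eq x 1 4, hH.decide_conn_eq x 2 4, hH.decide_conn_eq x 1 3,
    hH.decide_conn_eq x 2 3⟩

end Glue

/-! ## The two sides: the typed hub edges and the other typed edges -/

section Sides

variable {V : Type*} {E : Type*} [DecidableEq V] [DecidableEq E]
variable (ends : E → Sym2 V) (o a₁ a₂ a₃ b : V) (h : HubType)

/-- The typed edges at the confined marks. -/
def sideA (F : Finset E) : Finset E :=
  F.filter fun e => mark o a₁ a₂ a₃ b h.c₁ ∈ ends e ∨ mark o a₁ a₂ a₃ b h.c₂ ∈ ends e

/-- The typed edges at no confined mark. -/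
def sideB (F : Finset E) : Finset E :=
  F.filter fun e => ¬ (mark o a₁ a₂ a₃ b h.c₁ ∈ ends e ∨ mark o a₁ a₂ a₃ b h.c₂ ∈ ends e)

variable {ends o a₁ a₂ a₃ b h}

omit [DecidableEq E] in
/-- Membership in the hub side. -/
lemma mem_sideA {F : Finset E} {e : E} :
    e ∈ sideA ends o a₁ a₂ a₃ b h F ↔
      e ∈ F ∧ (mark o a₁ a₂ a₃ b h.c₁ ∈ ends e ∨ mark o a₁ a₂ a₃ b h.c₂ ∈ ends e) := by
  simp [sideA]

omit [DecidableEq E] in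
/-- Membership in the rest side. -/
lemma mem_sideB {F : Finset E} {e : E} :
    e ∈ sideB ends o a₁ a₂ a₃ b h F ↔
      e ∈ F ∧ ¬ (mark o a₁ a₂ a₃ b h.c₁ ∈ ends e ∨ mark o a₁ a₂ a₃ b h.c₂ ∈ ends e) := by
  simp [sideB]

/-- The two sides partition the typed set. -/
lemma sideA_union_sideB (F : Finset E) :
    sideA ends o a₁ a₂ a₃ b h F ∪ sideB ends o a₁ a₂ a₃ b h F = F :=
  Finset.filter_union_filter_not_eq _ F

omit [DecidableEq E] in
/-- The two sides are disjoint. -/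
lemma disjoint_sideA_sideB (F : Finset E) :
    Disjoint (sideA ends o a₁ a₂ a₃ b h F) (sideB ends o a₁ a₂ a₃ b h F) :=
  Finset.disjoint_filter_filter_not F F _

omit [DecidableEq E] in
/-- The hub side is inside the typed set. -/
lemma sideA_subset (F : Finset E) : sideA ends o a₁ a₂ a₃ b h F ⊆ F := Finset.filter_subset _ _

omit [DecidableEq E] in
/-- The rest side is inside the typed set. -/
lemma sideB_subset (F : Finset E) : sideB ends o a₁ a₂ a₃ b h F ⊆ F := Finset.filter_subset _ _

variable {slot : Fin 7 → Option E}

/-- The value of a slot only sees the hub side. -/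
lemma val_restr_sideA (hH : IsHub ends o a₁ a₂ a₃ b h slot) (i : Fin 7) {F : Finset E}
    {z x : Config E} (hx : ∀ e, e ∉ F → x e = z e) :
    val (slot i) (restr (sideA ends o a₁ a₂ a₃ b h F) z x) = val (slot i) x := by
  cases hi : slot i with
  | none => rfl
  | some e =>
    simp only [val]
    by_cases heF : e ∈ F
    · exact restr_of_mem (mem_sideA.2 ⟨heF, hH.mem_of_slot hi⟩)
    · rw [restr_of_not_mem (fun h' => heF (mem_sideA.1 h').1), hx e heF]

/-- The neighbour set only sees the hub side. -/
lemma nbr_restr_sideA (hH : IsHub ends o a₁ a₂ a₃ b h slot) {F : Finset E} {z x : Config E}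
    (hx : ∀ e, e ∉ F → x e = z e) :
    nbr slot (restr (sideA ends o a₁ a₂ a₃ b h F) z x) = nbr slot x := by
  unfold nbr
  simp only [val_restr_sideA hH _ hx]

/-- Closing the hub forgets the hub side. -/
lemma closeHub_restr_sideB {F : Finset E} {z x : Config E} (hx : ∀ e, e ∉ F → x e = z e) :
    closeHub ends (mark o a₁ a₂ a₃ b h.c₁) (mark o a₁ a₂ a₃ b h.c₂) (restr (sideB ends o a₁ a₂ a₃ b h F) z x) =
      closeHub ends (mark o a₁ a₂ a₃ b h.c₁) (mark o a₁ a₂ a₃ b h.c₂) x := by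
  funext e
  by_cases hhub : mark o a₁ a₂ a₃ b h.c₁ ∈ ends e ∨ mark o a₁ a₂ a₃ b h.c₂ ∈ ends e
  · rw [closeHub_apply_of_mem hhub, closeHub_apply_of_mem hhub]
  · rw [closeHub_apply_of_not_mem hhub, closeHub_apply_of_not_mem hhub]
    by_cases heF : e ∈ F
    · exact restr_of_mem (mem_sideB.2 ⟨heF, hhub⟩)
    · rw [restr_of_not_mem (fun h' => heF (mem_sideB.1 h').1), hx e heF]

/-- The pattern only sees the rest side. -/
lemma pat_restr_sideB {F : Finset E} {z x : Config E} (hx : ∀ e, e ∉ F → x e = z e) :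
    pat ends o a₁ a₂ a₃ b h (restr (sideB ends o a₁ a₂ a₃ b h F) z x) =
      pat ends o a₁ a₂ a₃ b h x := by
  unfold pat
  rw [closeHub_restr_sideB hx]

end Sides

end THub

end CovForm

end Summit.Ventures.PercRepro2
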